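import Summits.Ventures.QEC.Census.CertBZPlaneCover
import HarnessLib

/-!
# Lane-parallel replay of a Brouwer–Zimmermann matrix — soundness III: planes, threshold counter, stragglers
# (theorems only)

* `testBit_planeAcc` / `testBit_plane` — PLANE/LANE DUALITY: bit `b` of the plane of column `q` is bit `q` of the codeword
  that `laneSel` decodes for lane `b` (induction over the rows; the two cross terms cancel in `𝔽₂`).
* `counterInv_cAdd` / `counterInv_countCols` / `testBit_passMask` — the unary THRESHOLD COUNTER: after folding the
  columns `cols`, level `θ` has bit `b` iff lane `b`'s codeword has `≥ θ` set bits among `cols` (per lane: Boolean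
  bookkeeping only — no arithmetic across lanes, see the packing README in `CertBZPlaneLanes.lean`).
* `laneLeaf_of_failLoop` — the STRAGGLER LOOP verifies the tree's `bzLeaf` at every set bit of the mask it is given
  (whatever bit `hiBit` picks each round; soundness does not depend on the choice).
* `familyOK_sound` — per lane `b < N`: threshold met, or `bzLeaf` verified at the decoded lane.
Axioms standard.
-/

namespace Summit.Ventures.QEC.Census.Plane

open List

/-! ## Planes: bit `b` of the plane of column `q` = coordinate `q` of the codeword of lane `b` -/

/-- **Plane / lane duality** (general accumulator form): the plane of column `q` read at lane `b` is the `q`-th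
bit of lane `b`'s codeword as decoded by `laneSel` (any offset `j`, selection accumulator `u`, codeword
accumulator `c`). -/
theorem testBit_planeAcc (q b : ℕ) : ∀ (G X : List ℕ) (acc j u c : ℕ),
    (planeAcc q G X acc).testBit b = (acc.testBit b ^^ ((laneSel b G X j u c).2.testBit q ^^ c.testBit q))
  | [], X, acc, j, u, c => by
    cases X <;> simp only [planeAcc, laneSel] <;> cases acc.testBit b <;> cases c.testBit q <;> rfl
  | g :: gs, [], acc, j, u, c => by
    simp only [planeAcc, laneSel]
    cases acc.testBit b <;> cases c.testBit q <;> rfl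
  | g :: gs, x :: xs, acc, j, u, c => by
    rw [planeAcc, laneSel, bitAt_eq, bitAt_eq]
    cases hx : x.testBit b
    · -- lane `b` does not select this row
      simp only [cond_false]
      cases hg : g.testBit q
      · simp only [cond_false]
        exact testBit_planeAcc q b gs xs acc (j + 1) u c
      · simp only [cond_true]
        rw [testBit_planeAcc q b gs xs (Nat.xor acc x) (j + 1) u c, natXor_eq, Nat.testBit_xor, hx]
        cases acc.testBit b <;> cases c.testBit q <;> cases (laneSel b gs xs (j + 1) u c).2.testBit q <;> rfl
    · -- lane `b` selects this row
      simp only [cond_true]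
      cases hg : g.testBit q
      · simp only [cond_false]
        rw [testBit_planeAcc q b gs xs acc (j + 1) (Nat.xor u (Nat.pow 2 j)) (Nat.xor c g), natXor_eq c g,
          Nat.testBit_xor, hg]
        cases acc.testBit b <;> cases c.testBit q <;>
          cases (laneSel b gs xs (j + 1) (Nat.xor u (Nat.pow 2 j)) (c ^^^ g)).2.testBit q <;> rfl
      · simp only [cond_true]
        rw [testBit_planeAcc q b gs xs (Nat.xor acc x) (j + 1) (Nat.xor u (Nat.pow 2 j)) (Nat.xor c g),
          natXor_eq acc x, natXor_eq c g, Nat.testBit_xor, Nat.testBit_xor, hg, hx]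
        cases acc.testBit b <;> cases c.testBit q <;>
          cases (laneSel b gs xs (j + 1) (Nat.xor u (Nat.pow 2 j)) (c ^^^ g)).2.testBit q <;> rfl

/-- The plane of column `q` at lane `b` is bit `q` of the codeword of lane `b`. -/
theorem testBit_plane (q b : ℕ) (G X : List ℕ) :
    (planeAcc q G X 0).testBit b = (laneSel b G X 0 0 0).2.testBit q := by
  rw [testBit_planeAcc q b G X 0 0 0 0]
  simp

/-! ## The unary threshold counter -/

/-- `cAdd` keeps the length. -/
theorem length_cAdd (P : ℕ) : ∀ (c : ℕ) (Us : List ℕ), (cAdd P c Us).length = Us.length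
  | _, [] => rfl
  | c, U :: Us => by rw [cAdd, List.length_cons, length_cAdd P _ Us, List.length_cons]

/-- **One counter update**: feeding plane `P` raises the count of lane `b` by bit `b` of `P`. -/
theorem counterInv_cAdd (b P : ℕ) : ∀ (Us : List ℕ) (cnt i c : ℕ), 1 ≤ i → CounterInv b cnt i Us →
    c.testBit b = (decide (i ≤ cnt + 1) && P.testBit b) →
    CounterInv b (cnt + (P.testBit b).toNat) i (cAdd P c Us)
  | [], cnt, i, c, _, _, _ => fun k hk => absurd hk (Nat.not_lt_zero _)
  | U :: Us, cnt, i, c, hi, hUs, hc => by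
    intro k hk
    rw [cAdd] at hk ⊢
    have hU : U.testBit b = decide (i ≤ cnt) := by simpa using hUs 0 (by simp)
    rcases k with _ | k
    · rw [List.getD_cons_zero, natLor_eq, Nat.testBit_or, hU, hc, Nat.add_zero]
      cases hP : P.testBit b
      · simp
      · by_cases h1 : i ≤ cnt
        · have h2 : i ≤ cnt + 1 := by omega
          simp [h1, h2]
        · by_cases h2 : i ≤ cnt + 1
          · simp [h1, h2]
          · simp [h1, h2]
    · simp only [List.getD_cons_succ]
      have hUs' : CounterInv b cnt (i + 1) Us := fun k' hk' => by
        have := hUs (k' + 1) (by simpa using hk')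
        rw [List.getD_cons_succ] at this
        rw [this]
        congr 1
        simp only [eq_iff_iff]
        omega
      have hc' : (Nat.land U P).testBit b = (decide (i + 1 ≤ cnt + 1) && P.testBit b) := by
        change (U &&& P).testBit b = _
        rw [Nat.testBit_and, hU]
        congr 1
        simp only [decide_eq_decide]
        omega
      have := counterInv_cAdd b P Us cnt (i + 1) (Nat.land U P) (by omega) hUs' hc' k
        (by rw [List.length_cons, length_cAdd] at hk; simpa [length_cAdd] using hk)
      rw [this]
      congr 1
      simp only [eq_iff_iff]
      omega

/-- The counter update from level `1` (`cAddP`). -/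
theorem counterInv_cAddP (b P : ℕ) (Us : List ℕ) (cnt : ℕ) (h : CounterInv b cnt 1 Us) :
    CounterInv b (cnt + (P.testBit b).toNat) 1 (cAddP P Us) := by
  apply counterInv_cAdd b P Us cnt 1 P le_rfl h
  have : 1 ≤ cnt + 1 := by omega
  simp [this]

/-- `cAddP` keeps the length. -/
theorem length_cAddP (P : ℕ) (Us : List ℕ) : (cAddP P Us).length = Us.length := length_cAdd P P Us

/-- The all-zero counter: count `0`. -/
theorem counterInv_replicate (b θ : ℕ) : CounterInv b 0 1 (List.replicate θ 0) := by
  intro k hk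
  rw [getD_replicate_self, Nat.zero_testBit]
  symm
  simp

/-- **Folding the columns**: after `countCols`, the count of lane `b` is the number of listed columns `q` at which
lane `b`'s codeword has a set bit. -/
theorem counterInv_countCols (b : ℕ) (G X : List ℕ) : ∀ (cols : List ℕ) (Us : List ℕ) (cnt : ℕ),
    CounterInv b cnt 1 Us →
    CounterInv b (cnt + (cols.filter fun q => (laneSel b G X 0 0 0).2.testBit q).length) 1 (countCols G X cols Us)
  | [], Us, cnt, h => by simpa [countCols] using h
  | q :: qs, Us, cnt, h => by
    rw [countCols]
    have h1 := counterInv_cAddP b (planeAcc q G X 0) Us cnt h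
    rw [testBit_plane] at h1
    have h2 := counterInv_countCols b G X qs _ _ h1
    rw [List.filter_cons]
    cases hq : (laneSel b G X 0 0 0).2.testBit q
    · simpa [hq] using h2
    · simp only [hq, Bool.toNat_true] at h2 ⊢
      rw [show cnt + 1 + (qs.filter fun q => (laneSel b G X 0 0 0).2.testBit q).length =
        cnt + ((qs.filter fun q => (laneSel b G X 0 0 0).2.testBit q).length + 1) by omega] at h2
      simpa using h2

/-- `countCols` keeps the length. -/
theorem length_countCols (G X : List ℕ) : ∀ (cols Us : List ℕ), (countCols G X cols Us).length = Us.length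
  | [], Us => rfl
  | q :: qs, Us => by rw [countCols, length_countCols G X qs, length_cAddP]

/-- `lastD xs d` is entry `|xs|` of `d :: xs`. -/
theorem lastD_eq_getD : ∀ (xs : List ℕ) (d : ℕ), lastD xs d = (d :: xs).getD xs.length 0
  | [], d => by simp [lastD]
  | x :: xs, d => by rw [lastD, lastD_eq_getD xs x]; simp

/-- **The pass mask**: after counting the columns `cols` from the all-zero counter with `θ ≥ 1` levels, the last
level has bit `b` iff lane `b`'s codeword has at least `θ` set bits among `cols`. -/
theorem testBit_passMask (b θ : ℕ) (hθ : 1 ≤ θ) (G X cols : List ℕ) :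
    (lastD (countCols G X cols (List.replicate θ 0)) 0).testBit b =
      decide (θ ≤ (cols.filter fun q => (laneSel b G X 0 0 0).2.testBit q).length) := by
  obtain ⟨θ', rfl⟩ : ∃ θ', θ = θ' + 1 := ⟨θ - 1, by omega⟩
  have hlen : (countCols G X cols (List.replicate (θ' + 1) 0)).length = θ' + 1 := by
    rw [length_countCols, List.length_replicate]
  have hinv := counterInv_countCols b G X cols (List.replicate (θ' + 1) 0) 0 (counterInv_replicate b (θ' + 1))
  rw [Nat.zero_add] at hinv
  rw [lastD_eq_getD, hlen, List.getD_cons_succ, hinv θ' (by rw [hlen]; omega)]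
  congr 1
  simp only [eq_iff_iff]
  omega

/-! ## The straggler loop -/

/-- **Every set bit of the straggler mask is re-checked**: if `failLoop` passes on `F`, the leaf holds at every
lane `b` with bit `b` of `F` set (whichever bits `hiBit` picks: a picked bit is verified, the others survive into the
next mask). -/
theorem laneLeaf_of_failLoop (wmax : ℕ) (allow G X : List ℕ) :
    ∀ (fuel F : ℕ), failLoop wmax allow G X fuel F = true → ∀ b, F.testBit b = true → laneLeaf wmax allow G X b = true
  | 0, F, h, b, hb => by
    rw [failLoop, beq_zero_iff] at h
    subst h
    simp at hb
  | fuel + 1, F, h, b, hb => by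
    rw [failLoop] at h
    cases h0 : Nat.beq F 0
    · rw [h0, cond_false, Bool.and_eq_true] at h
      by_cases hbh : b = hiBit 25 F
      · rw [hbh]; exact h.1
      · refine laneLeaf_of_failLoop wmax allow G X fuel _ h.2 b ?_
        rw [natXor_eq, Nat.testBit_xor, hb, pow_eq, Nat.testBit_two_pow]
        have : ¬ (hiBit 25 F = b) := fun e => hbh e.symm
        simp [this]
    · rw [beq_zero_iff] at h0
      subst h0
      simp at hb

/-! ## One lane family -/

/-- **A passing family check**, lane by lane: for every lane `b < N`, either lane `b`'s codeword has at least
`θ ≥ 1` set bits among the columns `cols`, or the tree's leaf `bzLeaf` holds at the decoded (selection word,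
codeword) of lane `b`. -/
theorem familyOK_sound {wmax : ℕ} {cols allow G : List ℕ} {fam : ℕ × List ℕ} {θ fuel : ℕ} (hθ : 1 ≤ θ)
    (h : familyOK wmax cols allow G fam θ fuel = true) (b : ℕ) (hb : b < fam.1) :
    θ ≤ (cols.filter fun q => (laneSel b G fam.2 0 0 0).2.testBit q).length ∨
      bzLeaf wmax allow (laneSel b G fam.2 0 0 0).1 (laneSel b G fam.2 0 0 0).2 = true := by
  rw [familyOK] at h
  by_cases hp : θ ≤ (cols.filter fun q => (laneSel b G fam.2 0 0 0).2.testBit q).length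
  · exact Or.inl hp
  · right
    have hF := laneLeaf_of_failLoop wmax allow G fam.2 fuel _ h b (by
      rw [natXor_eq, Nat.testBit_xor, testBit_ones, testBit_passMask b θ hθ]
      simp [hb, hp])
    exact hF

end Summit.Ventures.QEC.Census.Plane
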